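import Summits.HodgeConjecture.CorCM.Census.TwentyFourDicyclicFaces

/-!
# Degree-24 atlas, type `Dic₆` (sequel): the TWO block-parity relations on the Hodge lattice and the cyclic index-two subgroup `⟨a⟩`
# (kernel census; the ingredients of the minimality `μ(Dic₆) ≥ 172` of `Census/TwentyFourDicyclicMinimality.lean`)

COR-CM (cell `pub-hodgecm2`), count-neutral kernel census by the literature seat lit-andre-3 (gen 17; claim TWENTYFOUR-DICYCLIC), sequel of
`Census/TwentyFourDicyclicFaces.lean` (same conventions, dictionary and citations).  The `172` block parities `v ↦ Σ_{x ∈ block b} v(x)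
mod 2` of this type satisfy TWO relations on the Hodge lattice `H` (b09's `Census/BlockParityLaw.lean`: `1 + δ` relations, `δ = [exp G ∣
12] = 1` here): the blocks split `86 + 86` into the classes `A ∋ S₀, B₀` and `B ∋ S₁, B₁` (`relAList`/`inRelA`), and
`Σ_{b ∈ A} parity_b ≡ 0`, `Σ_{b ∈ B} parity_b ≡ 0 (mod 2)` on `H` (**`rel_hodge`**).  PROOF (kernel): `A` is exactly the set of blocks whose
types meet the transversal `Tr = {a⁰, …, a⁵, xa⁰, …, xa⁵}` of `G/⟨c⟩` in an ODD number of elements (`inRelA_spec`, decided label by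
label: `cnt x = |Ψ_x ∩ Tr|` is odd iff the block of `x` is in `A`); `2·cnt(x) = Σ_{τ ∈ Tr} σ_τ(x) + 12` (`two_cnt`), so on `H`, where
every Pohlmann form `σ_τ` vanishes, `Σ_x cnt(x) v(x) = 6 Σ_x v(x)` (`sum_cnt_mul`) is even: that is relation `A` (`relA_hodge`); the
universal relation `Σ_x v(x) ≡ σ_1 · v = 0` (`total_hodge`) gives `B = Aᶜ`.  Also here: `cosetA` (does the label's embedding lie in the
cyclic index-two subgroup `⟨a⟩ ◁ G`, resp. in its image `⟨ā⟩ ⊂ Q₈` for a fourfold label) with `cosetA_facts` (preserved by `c = a⁶` and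
by `a`, reversed by `x`) — the HALF-PARITIES built from it in the sequel are the two `G`-invariant functionals on `H/P ⊗ 𝔽₂` beyond
the parities.  No named fact, no `sorry`.  HC_CM is not proved anywhere in this cell; nothing here is a headline.

## References
* [Pohlmann1968] H. Pohlmann, Algebraic cycles on abelian varieties of complex multiplication type, Ann. of Math. 88 (1968), Thm 1.
* [Milne1999] J. S. Milne, Lefschetz motives and the Tate conjecture, Compositio Math. 117 (1999), Prop. 2.1, p. 54.
-/

namespace Summit.HodgeConjecture.CorCM.Census.TwentyFourDicyclicSpecies

open Finset QuaternionGroup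

/-! ## The two parity relations and the half-parities -/

/-- The block of a translated label is the block of the label. [folklore] -/
theorem blockOf_act (g : G) : ∀ x : Pt, blockOf (act g x) = blockOf x := by
  rintro (⟨i, u⟩ | ⟨b, h⟩) <;> rfl

set_option maxRecDepth 100000 in
/-- The relation class `A` (by block index; `true` = `A`, `false` = `B`; `86 + 86`; `S₀, B₀ = 2 ∈ A`, `S₁, B₁ = 3 ∈ B`). [folklore] -/
def relAList : List Bool :=
  [true, false, true, false, true, false, true, false, false, true, true, false, false, true, false, true, true, false, true, false, false, true, false, true, true, false, false, true, true,
    false, true, false, false, true, true, false, false, true, false, true, true, false, false, true, true, false, true, false, false, true, true, false, true, false, false, true, true, false,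
    false, true, false, true, true, true, false, false, true, false, true, true, false, false, true, true, false, false, true, false, true, true, false, true, false, false, true, true, false,
    false, true, false, true, false, true, false, false, true, true, false, false, true, true, false, false, true, true, false, true, true, false, false, true, false, true, true, false, false,
    true, true, false, true, false, false, true, false, true, true, false, false, true, false, false, true, false, true, false, true, false, false, true, true, true, true, false, false, true,
    false, false, true, true, false, true, true, false, true, true, false, true, false, false, true, true, true, true, false, true, false, false, false, false, true, false, false]

/-- Is the block `b` in the relation class `A`? [folklore] -/
def inRelA (b : ℕ) : Bool := relAList.getD b false

/-- Does the label's embedding lie in the cyclic index-two subgroup `⟨a⟩` (for a fourfold label: in its image `⟨ā⟩ ⊂ Q₈`)? [folklore] -/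
def cosetA : Pt → Bool
  | Sum.inl (_, a _) => true
  | Sum.inl (_, xa _) => false
  | Sum.inr (_, a _) => true
  | Sum.inr (_, xa _) => false

set_option maxRecDepth 100000 in set_option maxHeartbeats 4000000 in
/-- `⟨a⟩`-membership is preserved by `c = a⁶` and by `a`, and reversed by `x`. [folklore] -/
theorem cosetA_facts : (∀ x : Pt, cosetA (act (a 6) x) = cosetA x) ∧ (∀ x : Pt, cosetA (act (a 1) x) = cosetA x) ∧
    (∀ x : Pt, cosetA (act (xa 0) x) = !cosetA x) := by
  refine ⟨by decide +kernel, by decide +kernel, by decide +kernel⟩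

/-- The transversal `{a⁰, …, a⁵, xa⁰, …, xa⁵}` of `G/⟨c⟩`. [folklore] -/
def tr (t : Fin 12) : G := if t.val < 6 then a ((t.val : ℕ) : ZMod 12) else xa (((t.val - 6 : ℕ) : ℕ) : ZMod 12)

/-- The number of transversal elements in the corner type of a label. [folklore] -/
def cnt (x : Pt) : ℕ := ∑ t : Fin 12, if inPhi (act (tr t) x) then 1 else 0

set_option maxRecDepth 100000 in set_option maxHeartbeats 4000000 in
/-- **The relation class `A` = the blocks whose types meet the transversal oddly** (decided label by label, in three chunks). [folklore] -/
theorem inRelA_spec : (∀ p : Fin 2 × QuaternionGroup 2, cnt (Sum.inl p) % 2 = if inRelA (blockOf (Sum.inl p : Pt)) then 1 else 0) ∧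
    (∀ b : Fin 85, ∀ h : G, cnt (q ⟨b.val, by omega⟩ h) % 2 = if inRelA (b.val + 2) then 1 else 0) ∧
    (∀ b : Fin 85, ∀ h : G, cnt (q ⟨85 + b.val, by omega⟩ h) % 2 = if inRelA (85 + b.val + 2) then 1 else 0) := by
  refine ⟨by decide +kernel, by decide +kernel, by decide +kernel⟩

/-- `cnt x` is odd exactly on the `A`-blocks. [folklore] -/
theorem cnt_mod_two (x : Pt) : cnt x % 2 = if inRelA (blockOf x) then 1 else 0 := by
  obtain ⟨hs, hq1, hq2⟩ := inRelA_spec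
  rcases x with p | ⟨b, h⟩
  · exact hs p
  · by_cases hb : b.val < 85
    · exact hq1 ⟨b.val, hb⟩ h
    · have e : (⟨85 + (b.val - 85), by omega⟩ : Fin 170) = b := Fin.ext (by simp only; omega)
      have h2 := hq2 ⟨b.val - 85, by omega⟩ h
      rw [e] at h2
      rw [h2]
      exact if_congr (by rw [show 85 + (b.val - 85) + 2 = b.val + 2 by omega]; exact Iff.rfl) rfl rfl

/-- `2·cnt x = Σ_t σ_{tr t}(x) + 12`. [folklore] -/
theorem two_cnt (x : Pt) : 2 * (cnt x : ℤ) = (∑ t : Fin 12, hodgeVec (tr t) x) + 12 := by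
  unfold cnt hodgeVec
  push_cast
  have h12 : (12 : ℤ) = ∑ _t : Fin 12, (1 : ℤ) := by simp
  rw [h12, ← Finset.sum_add_distrib, Finset.mul_sum]
  refine Finset.sum_congr rfl fun t _ => ?_
  split_ifs <;> norm_num

/-- On the Hodge lattice `Σ_x cnt(x) v(x) = 6 Σ_x v(x)`. [folklore] -/
theorem sum_cnt_mul {v : Pt → ℤ} (hv : v ∈ hodgeLattice) : ∑ x : Pt, (cnt x : ℤ) * v x = 6 * ∑ x : Pt, v x := by
  have h1 : ∀ x : Pt, 2 * ((cnt x : ℤ) * v x) = (∑ t : Fin 12, hodgeVec (tr t) x * v x) + 12 * v x := by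
    intro x
    rw [← mul_assoc, two_cnt, add_mul, Finset.sum_mul]
  have h2 : 2 * ∑ x : Pt, (cnt x : ℤ) * v x = 2 * (6 * ∑ x : Pt, v x) := by
    rw [Finset.mul_sum, Finset.sum_congr rfl fun x _ => h1 x, Finset.sum_add_distrib, Finset.sum_comm, ← Finset.mul_sum]
    have h0 : ∑ t : Fin 12, ∑ x : Pt, hodgeVec (tr t) x * v x = 0 :=
      Finset.sum_eq_zero fun t _ => hv (tr t)
    rw [h0, zero_add]
    ring
  exact mul_left_cancel₀ two_ne_zero h2

/-- **Relation `A` on the Hodge lattice**: `Σ_{x ∈ A-blocks} v(x) ≡ 0 (mod 2)`. [folklore] -/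
theorem relA_hodge {v : Pt → ℤ} (hv : v ∈ hodgeLattice) : (∑ x : Pt, if inRelA (blockOf x) then ((v x : ℤ) : ZMod 2) else 0) = 0 := by
  have h : (((∑ x : Pt, (cnt x : ℤ) * v x : ℤ)) : ZMod 2) = 0 := by
    rw [sum_cnt_mul hv, Int.cast_mul, show ((6 : ℤ) : ZMod 2) = 0 by decide, zero_mul]
  rw [Int.cast_sum] at h
  refine Eq.trans (Finset.sum_congr rfl fun x _ => ?_) h
  rw [Int.cast_mul, Int.cast_natCast, ← ZMod.natCast_mod (cnt x) 2, cnt_mod_two x]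
  split_ifs <;> simp

/-- **The universal relation**: `Σ_x v(x) ≡ 0 (mod 2)` on the Hodge lattice (`σ_1 ≡ 1`). [folklore] -/
theorem total_hodge {v : Pt → ℤ} (hv : v ∈ hodgeLattice) : (∑ x : Pt, ((v x : ℤ) : ZMod 2)) = 0 := by
  have h : (((hodgeVec 1 ⬝ᵥ v : ℤ)) : ZMod 2) = 0 := by rw [hv 1, Int.cast_zero]
  rw [dotProduct, Int.cast_sum] at h
  refine Eq.trans (Finset.sum_congr rfl fun x _ => ?_) h
  have e : ((hodgeVec 1 x : ℤ) : ZMod 2) = 1 := by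
    unfold hodgeVec
    split_ifs <;> decide
  rw [Int.cast_mul, e, one_mul]

/-- **Both relations on the Hodge lattice** (`c = true`: class `A`; `c = false`: class `B`): the `172` block parities span only `170`
dimensions of `(H/P ⊗ 𝔽₂)^*`. [folklore] -/
theorem rel_hodge (c : Bool) {v : Pt → ℤ} (hv : v ∈ hodgeLattice) :
    (∑ x : Pt, if (inRelA (blockOf x) == c) then ((v x : ℤ) : ZMod 2) else 0) = 0 := by
  cases c
  · have e : ∀ x : Pt, (if (inRelA (blockOf x) == false) then ((v x : ℤ) : ZMod 2) else 0) =
        ((v x : ℤ) : ZMod 2) - (if inRelA (blockOf x) then ((v x : ℤ) : ZMod 2) else 0) := by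
      intro x
      cases inRelA (blockOf x) <;> simp
    simp_rw [e]
    rw [Finset.sum_sub_distrib, total_hodge hv, relA_hodge hv, sub_zero]
  · have e : ∀ x : Pt, (if (inRelA (blockOf x) == true) then ((v x : ℤ) : ZMod 2) else 0) =
        (if inRelA (blockOf x) then ((v x : ℤ) : ZMod 2) else 0) := by
      intro x
      cases inRelA (blockOf x) <;> simp
    simp_rw [e]
    exact relA_hodge hv

end Summit.HodgeConjecture.CorCM.Census.TwentyFourDicyclicSpecies
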